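import Literature.MathematicalPhysics.QuantumFieldTheory.LatticeGauge
import Mathlib.Analysis.CStarAlgebra.Matrix
import HarnessLib

/-!
# The Durhuus–Fröhlich slab criterion for Wilson's area law, as restated and used by
# Cao–Nissim–Sheffield (arXiv:2509.04688, Definition 2.1 and Theorem 2.3)

Durhuus–Fröhlich (CMP 75 (1980) 103–151, Thms. 1.2–1.3) reduce Wilson's area law for a
`d`-dimensional lattice gauge theory whose group has a non-trivial central element to a mass gap,
UNIFORM IN THE BOUNDARY FIELDS, of the `(d-1)`-dimensional non-linear `σ`-models obtained by
conditioning on the two horizontal planes bounding a height-`1` slab. Cao–Nissim–Sheffield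
(arXiv:2509.04688v2, §2) restate the criterion in the 't Hooft-scaled Wilson normalisation
`S(Q) = Nβ Re ∑ₚ Tr Q_p` and use it (their Theorem 2.3) — this file vendors exactly that restatement,
for `G = SU(N)` (`N ≥ 2`, central element `e^{2πi/N} I ≠ I`):

* `slabAction N β A B Q = Nβ ∑_{e=(x,y)} Re Tr(Q_x A_e Q_y⁻¹ B_e⁻¹)` on `Q : (ℤ/Lℤ)^{n} → SU(N)` with
  boundary fields `A, B : edges → U(N)` (CNS Definition 2.1; `n = d-1` is the slice dimension, edges
  `e = (x, i)` from `x` to `x + eᵢ` as in `ConstructiveQFTWave0`), and the slab `σ`-model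
  `slabMeasure = Z⁻¹ exp(S_{A,B}) ∏ₓ dQ_x` as the tilt of product Haar measure ((2.1) ibid.);
* `torusGraphDist`, the graph (periodic `ℓ¹`) distance on the slice `(ℤ/Lℤ)^n`;
* the named fact `durhuusFrohlich_areaLaw_of_slabClustering d N` (CNS Thm. 2.3 = DF80 Thms. 1.2–1.3):
  boundary-uniform exponential decay of the covariances of single-site matrix entries `(Q_x)_{ij}`,
  `(Q_y⁻¹)_{kl}` under `slabMeasure` ⇒ Wilson's area law for `SU(N)` lattice Yang–Mills on every torus
  `(ℤ/Lℤ)^d` at tree coupling `N β` (conclusion in the torus vocabulary of `ConstructiveQFTWave0`, the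
  same shape as `cao_nissim_sheffield`), plus its corollary in
  the shape `HasAreaLaw` (proved).

Faithfulness notes. (a) The printed hypothesis bounds the complex covariance
`Cov_{A,B}(f_x^{i₁j₁}, g_y^{i₂j₂})`, `f = (Q_x)_{i₁j₁}`, `g = (Q_y⁻¹)_{i₂j₂}`; we ask for the same bound
on the four real covariances of real/imaginary parts, which implies the printed hypothesis with
`C₁ ↦ 4C₁` — so the fact below is implied by the printed theorem. (b) CNS allow any compact
`G ⊆ U(N)` containing some `zI`, `z ≠ 1`; we state `G = SU(N)`, `N ≥ 2` only —
TODO(general form): compact `G ⊆ U(N)` with non-trivial scalar element, and `SO(2N)`. (c) "constants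
`C₁, C₂`" are read with `0 < C₂` on both sides (otherwise vacuous). (d) `β ≥ 0` as printed.
(e) Normalisation: tree coupling `β' = Nβ` (`wilsonMeasure ρ β'` has weight
`exp(-β' ∑ₚ (N - Re Tr U_p))`), as recorded for `shen_zhu_zhu`. (f) The slice of the `d`-torus of side
`L` is the `(d-1)`-torus of the same side `L`; CNS Remark 1.2: torus vs free box immaterial.

Nothing here is proved about the slab models themselves (the single-site tilted-Haar structure, the
Dobrushin door) — that is the venture's business (`Summits/Ventures/YMGap`).

## References

* B. Durhuus, J. Fröhlich, *A connection between ν-dimensional Yang–Mills theory and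
  (ν−1)-dimensional, non-linear σ-models*, Comm. Math. Phys. 75 (1980) 103–151, Thms. 1.2–1.3
  (cited through CNS; primary cite-only, acq-03419).
* S. Cao, R. Nissim, S. Sheffield, *Dynamical approach to area law for lattice Yang–Mills*,
  arXiv:2509.04688v2, Definition 2.1, Remark 2.2, Theorem 2.3 (p. 3–4) [CaoNissimSheffield2025dynamical].
-/

noncomputable section

open MeasureTheory ProbabilityTheory
open Literature.MathematicalPhysics.QuantumLattice

namespace Literature.MathematicalPhysics.QuantumFieldTheory

/-! ### The slab `σ`-model (CNS Definition 2.1) -/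

section Slab

variable {n L : ℕ}

/-- The graph distance on the discrete torus `(ℤ/Lℤ)^n` (nearest-neighbour graph = periodic `ℓ¹`
distance): `d(x,y) = ∑ᵢ |x_i - y_i|_{ℤ/L}` with `|a|_{ℤ/L} = |valMinAbs a|` (Friedli–Velenik 2017 §3.1,
the graph metric of the torus `𝕋_L`). [cite: FriedliVelenik2017, §3.1] -/
def torusGraphDist (x y : Site n L) : ℕ := ∑ i, ((x i - y i).valMinAbs).natAbs

/-- `d(x,x) = 0` for the torus graph distance. [cite: FriedliVelenik2017, §3.1] -/
@[simp] theorem torusGraphDist_self (x : Site n L) : torusGraphDist x x = 0 := by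
  simp [torusGraphDist]

/-- `d(x,y) = d(y,x)` for the torus graph distance. [cite: FriedliVelenik2017, §3.1] -/
theorem torusGraphDist_comm (x y : Site n L) : torusGraphDist x y = torusGraphDist y x := by
  unfold torusGraphDist
  refine Finset.sum_congr rfl fun i _ => ?_
  rw [← ZMod.natAbs_valMinAbs_neg, neg_sub]

variable (N : ℕ) [NeZero L]

/-- **The slab `σ`-model action** (Cao–Nissim–Sheffield Definition 2.1, after Durhuus–Fröhlich
1980): for boundary fields `A, B : E⁺(Λ^{n}) → U(N)` and a spin configuration `Q : Λ^{n} → SU(N)` on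
the slice torus `Λ^n = (ℤ/Lℤ)^n` (`n = d - 1`),
`S_{A,B}(Q) = N β ∑_{e = (x, x+eᵢ)} Re Tr(Q_x A_e Q_{x+eᵢ}⁻¹ B_e⁻¹)` ('t Hooft coupling `β`). [cite: CaoNissimSheffield2025dynamical, Definition 2.1] -/
def slabAction (β : ℝ) (A B : Edge n L → Matrix.unitaryGroup (Fin N) ℂ)
    (Q : Site n L → Matrix.specialUnitaryGroup (Fin N) ℂ) : ℝ :=
  (N : ℝ) * β * ∑ e : Edge n L,
    ((Q e.1 : Matrix (Fin N) (Fin N) ℂ) * (A e : Matrix (Fin N) (Fin N) ℂ) *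
      ((Q (e.1.shift e.2))⁻¹ : Matrix.specialUnitaryGroup (Fin N) ℂ) *
        ((B e)⁻¹ : Matrix.unitaryGroup (Fin N) ℂ)).trace.re

/-- **The slab `σ`-model** `dμ_{A,B}(Q) = Z_{A,B}⁻¹ exp(S_{A,B}(Q)) ∏ₓ dQ_x` (product Haar measure on
`SU(N)^{Λ^n}` tilted by the slab action; CNS (2.1)). [cite: CaoNissimSheffield2025dynamical, Definition 2.1] -/
def slabMeasure (β : ℝ) (A B : Edge n L → Matrix.unitaryGroup (Fin N) ℂ) :
    Measure (Site n L → Matrix.specialUnitaryGroup (Fin N) ℂ) :=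
  (Measure.pi fun _ : Site n L => haarProbability (Matrix.specialUnitaryGroup (Fin N) ℂ)).tilted
    (slabAction N β A B)

/-- At `β = 0` the slab action vanishes. [cite: CaoNissimSheffield2025dynamical, Definition 2.1] -/
@[simp] theorem slabAction_zero (A B : Edge n L → Matrix.unitaryGroup (Fin N) ℂ)
    (Q : Site n L → Matrix.specialUnitaryGroup (Fin N) ℂ) : slabAction N 0 A B Q = 0 := by
  simp [slabAction]

/-- At `β = 0` the slab `σ`-model is product Haar measure. [cite: CaoNissimSheffield2025dynamical, Definition 2.1] -/
theorem slabMeasure_zero (A B : Edge n L → Matrix.unitaryGroup (Fin N) ℂ) :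
    slabMeasure (n := n) (L := L) N 0 A B =
      Measure.pi fun _ : Site n L => haarProbability (Matrix.specialUnitaryGroup (Fin N) ℂ) := by
  have h : slabAction (n := n) (L := L) N 0 A B = 0 := funext fun Q => slabAction_zero N A B Q
  rw [slabMeasure, h]
  exact tilted_zero _

/-- The slab `σ`-model is a probability measure (the action is bounded: `|S_{A,B}| ≤ Nβ·|E⁺|·N`,
so `exp S` is integrable against the product Haar probability measure). [cite: CaoNissimSheffield2025dynamical, Definition 2.1] -/
theorem isProbabilityMeasure_slabMeasure (β : ℝ) (A B : Edge n L → Matrix.unitaryGroup (Fin N) ℂ) :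
    IsProbabilityMeasure (slabMeasure (n := n) (L := L) N β A B) := by
  classical
  haveI : SecondCountableTopology (Matrix (Fin N) (Fin N) ℂ) :=
    inferInstanceAs (SecondCountableTopology (Fin N → Fin N → ℂ))
  haveI : SecondCountableTopology (Matrix.specialUnitaryGroup (Fin N) ℂ) :=
    Topology.IsEmbedding.subtypeVal.secondCountableTopology
  unfold slabMeasure
  set π : Measure (Site n L → Matrix.specialUnitaryGroup (Fin N) ℂ) :=
    Measure.pi fun _ : Site n L => haarProbability (Matrix.specialUnitaryGroup (Fin N) ℂ) with hπ
  haveI : IsProbabilityMeasure π := by rw [hπ]; infer_instance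
  -- the action is bounded by `N |β| ∑_e N`
  have hbound : ∀ Q, |slabAction (n := n) (L := L) N β A B Q| ≤
      (N : ℝ) * |β| * ∑ _e : Edge n L, (N : ℝ) := by
    intro Q
    unfold slabAction
    rw [abs_mul, abs_mul, Nat.abs_cast]
    refine mul_le_mul_of_nonneg_left ?_ (by positivity)
    refine (Finset.abs_sum_le_sum_abs _ _).trans (Finset.sum_le_sum fun e _ => ?_)
    set M : Matrix (Fin N) (Fin N) ℂ :=
      (Q e.1 : Matrix (Fin N) (Fin N) ℂ) * (A e : Matrix (Fin N) (Fin N) ℂ) *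
        ((Q (e.1.shift e.2))⁻¹ : Matrix.specialUnitaryGroup (Fin N) ℂ) *
          ((B e)⁻¹ : Matrix.unitaryGroup (Fin N) ℂ) with hM
    have hMu : M ∈ Matrix.unitaryGroup (Fin N) ℂ := by
      rw [hM]
      refine Submonoid.mul_mem _ (Submonoid.mul_mem _ (Submonoid.mul_mem _ ?_ (A e).2) ?_) ((B e)⁻¹).2
      · exact (Q e.1).2.1
      · exact ((Q (e.1.shift e.2))⁻¹).2.1
    -- entries of a unitary matrix are bounded by 1, so `|Re Tr M| ≤ N`
    have hentry : ∀ i j, ‖M i j‖ ≤ 1 := fun i j => entry_norm_bound_of_unitary hMu i j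
    calc |(M.trace).re| ≤ ‖M.trace‖ := Complex.abs_re_le_norm _
      _ = ‖∑ i, M i i‖ := by rw [Matrix.trace]; rfl
      _ ≤ ∑ i, ‖M i i‖ := norm_sum_le _ _
      _ ≤ ∑ _i : Fin N, (1 : ℝ) := Finset.sum_le_sum fun i _ => hentry i i
      _ = N := by simp
  have hmeas : Measurable (slabAction (n := n) (L := L) N β A B) := by
    unfold slabAction
    refine measurable_const.mul (Finset.measurable_sum _ fun e _ => ?_)
    have hc : Continuous fun Q : Site n L → Matrix.specialUnitaryGroup (Fin N) ℂ =>
        ((Q e.1 : Matrix (Fin N) (Fin N) ℂ) * (A e : Matrix (Fin N) (Fin N) ℂ) *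
          ((Q (e.1.shift e.2))⁻¹ : Matrix.specialUnitaryGroup (Fin N) ℂ) *
            ((B e)⁻¹ : Matrix.unitaryGroup (Fin N) ℂ)).trace.re := by
      refine Complex.continuous_re.comp (Continuous.matrix_trace ?_)
      refine ((Continuous.mul (Continuous.mul ?_ continuous_const) ?_).mul continuous_const)
      · exact continuous_subtype_val.comp (continuous_apply e.1)
      · exact continuous_subtype_val.comp ((continuous_apply (e.1.shift e.2)).inv)
    exact hc.measurable
  refine isProbabilityMeasure_tilted ?_
  refine Integrable.of_bound (hmeas.exp).aestronglyMeasurable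
    (Real.exp ((N : ℝ) * |β| * ∑ _e : Edge n L, (N : ℝ))) (Filter.Eventually.of_forall fun Q => ?_)
  rw [Real.norm_eq_abs, Real.abs_exp]
  exact Real.exp_le_exp.2 ((le_abs_self _).trans (hbound Q))

end Slab

/-! ### The criterion (CNS Theorem 2.3 = Durhuus–Fröhlich Thms. 1.2–1.3), named fact -/

section Criterion

variable {d N : ℕ}

variable (d N) in
/-- **Durhuus–Fröhlich slab criterion for Wilson's area law** (DF80 Thms. 1.2–1.3, in the restatement
used by Cao–Nissim–Sheffield, arXiv:2509.04688v2 Theorem 2.3), case `G = SU(N)`, `N ≥ 2` (central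
element `e^{2πi/N} I ≠ I`), `d ≥ 2`, 't Hooft coupling `β ≥ 0`. HYPOTHESIS (boundary-uniform slab
clustering): there are constants `C₁, C₂` (`0 < C₂`) depending only on `(N, d, β)` — in particular not on
the slab size `L` nor on the boundary fields `A, B : E⁺((ℤ/Lℤ)^{d-1}) → U(N)` — such that for all
`L, A, B`, all sites `x, y` of the slice torus `(ℤ/Lℤ)^{d-1}`, all indices `i j k l` and
`φ, ψ ∈ {Re, Im}`:
`|Cov_{μ_{A,B}}(φ (Q_x)_{ij}, ψ (Q_y⁻¹)_{kl})| ≤ C₁ e^{-C₂ d(x,y)}` (`μ_{A,B} = slabMeasure`,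
`d = torusGraphDist`). CONCLUSION (area law): there are `C₁', C₂' > 0` (depending on `N, d, β`) such
that on every torus `(ℤ/Lℤ)^d`, for every rectangular `R × T` loop in a coordinate plane with
`1 ≤ R, T` and `2R, 2T ≤ L`, `|⟨W_{R×T}⟩_{Λ_L, Nβ}| ≤ C₁' exp(-C₂' RT)` for the `SU(N)` Wilson theory
at tree coupling `Nβ` (`W = (1/N) Re Tr`, `wilsonLoop`). Printed: "Suppose that there exist constants
`C₁` and `C₂` only depending on `G, d, β` (and in particular not on `A, B`) such that for any
`x, y ∈ Λ^{d-1}` and `i₁, j₁, i₂, j₂ ∈ [N]`, we have that `|Cov_{A,B}(f_x^{i₁j₁}, g_y^{i₂j₂})| ≤ C₁ e^{-C₂ d(x,y)}`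
… Then … there are constants `C₁, C₂` only depending on `G, d, β` such that for any rectangular loop
`ℓ` in the lattice `Λ`, where the side lengths of `ℓ` are at most `L/2`, we have that
`|⟨W_ℓ⟩_{Λ,β}| ≤ C₁ exp(-C₂ area(ℓ))`." See the module docstring for the faithfulness notes
(real/imaginary parts; `SU(N)` only; `0 < C₂`). [cite: CaoNissimSheffield2025dynamical, Theorem 2.3] -/
def durhuusFrohlich_areaLaw_of_slabClustering : Prop :=
  ∀ (hd : 2 ≤ d) (hN : 2 ≤ N) (β : ℝ), 0 ≤ β →
    (∃ C₁ C₂ : ℝ, 0 < C₂ ∧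
      ∀ (L : ℕ) [NeZero L] (A B : Edge (d - 1) L → Matrix.unitaryGroup (Fin N) ℂ)
        (x y : Site (d - 1) L) (i j k l : Fin N) (φ ψ : ℂ → ℝ),
        (φ = Complex.re ∨ φ = Complex.im) → (ψ = Complex.re ∨ ψ = Complex.im) →
          |cov[fun Q => φ ((Q x : Matrix (Fin N) (Fin N) ℂ) i j),
              fun Q => ψ ((((Q y)⁻¹ : Matrix.specialUnitaryGroup (Fin N) ℂ) :
                Matrix (Fin N) (Fin N) ℂ) k l);
              slabMeasure N β A B]| ≤ C₁ * Real.exp (-C₂ * torusGraphDist x y)) →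
    ∃ C₁ C₂ : ℝ, 0 < C₂ ∧ ∀ (L : ℕ) [NeZero L] (x : Site d L) (i j : Fin d) (R T : ℕ), i ≠ j →
      1 ≤ R → 1 ≤ T → 2 * R ≤ L → 2 * T ≤ L →
        |wilsonExpectation (fundamentalRep (Fin N)) (N * β)
            (wilsonLoop (fundamentalRep (Fin N)) x i j R T)| ≤ C₁ * Real.exp (-C₂ * (R * T))

/-- A bound `C e^{-c RT}` for `R + T ≥ 1` is a bound `max(C,1)^{2(R+T)} e^{-c RT}`, the shape of
`HasAreaLaw` (private helper). [folklore] -/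
private theorem le_max_one_pow_of_le' {a C : ℝ} {m : ℕ} (hm : 1 ≤ m) (h : a ≤ C) :
    a ≤ max C 1 ^ m := by
  calc a ≤ C := h
    _ ≤ max C 1 := le_max_left _ _
    _ = max C 1 ^ 1 := (pow_one _).symm
    _ ≤ max C 1 ^ m := pow_le_pow_right₀ (le_max_right _ _) hm

/-- **Corollary** (the criterion in the shape of the tree's finite-volume area law `HasAreaLaw`):
under `durhuusFrohlich_areaLaw_of_slabClustering d N`, boundary-uniform slab clustering at 't Hooft
coupling `β ≥ 0` gives `HasAreaLaw d (fundamentalRep (Fin N)) (N β)`. [cite: CaoNissimSheffield2025dynamical, Theorem 2.3] -/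
theorem durhuusFrohlich_areaLaw_of_slabClustering.hasAreaLaw
    (h : durhuusFrohlich_areaLaw_of_slabClustering d N) (hd : 2 ≤ d) (hN : 2 ≤ N) {β : ℝ}
    (hβ : 0 ≤ β)
    (hslab : ∃ C₁ C₂ : ℝ, 0 < C₂ ∧
      ∀ (L : ℕ) [NeZero L] (A B : Edge (d - 1) L → Matrix.unitaryGroup (Fin N) ℂ)
        (x y : Site (d - 1) L) (i j k l : Fin N) (φ ψ : ℂ → ℝ),
        (φ = Complex.re ∨ φ = Complex.im) → (ψ = Complex.re ∨ ψ = Complex.im) →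
          |cov[fun Q => φ ((Q x : Matrix (Fin N) (Fin N) ℂ) i j),
              fun Q => ψ ((((Q y)⁻¹ : Matrix.specialUnitaryGroup (Fin N) ℂ) :
                Matrix (Fin N) (Fin N) ℂ) k l);
              slabMeasure N β A B]| ≤ C₁ * Real.exp (-C₂ * torusGraphDist x y)) :
    HasAreaLaw d (fundamentalRep (Fin N)) ((N : ℝ) * β) := by
  obtain ⟨C, c, hc, hW⟩ := h hd hN β hβ hslab
  refine ⟨max C 1, c, hc, fun L _ x i j R T hij hR hT hRL hTL => ?_⟩
  have h1 := hW L x i j R T hij hR hT hRL hTL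
  have hexp : 0 < Real.exp (-c * ((R : ℝ) * T)) := Real.exp_pos _
  have h2 : |wilsonExpectation (fundamentalRep (Fin N)) ((N : ℝ) * β)
      (wilsonLoop (fundamentalRep (Fin N)) x i j R T)| / Real.exp (-c * ((R : ℝ) * T)) ≤ C := by
    rw [div_le_iff₀ hexp]; exact h1
  have h3 := le_max_one_pow_of_le' (m := 2 * (R + T)) (by omega) h2
  rwa [div_le_iff₀ hexp] at h3

/-- **Consistency with Cao–Nissim–Sheffield Theorem 1.6**: the criterion together with their
Proposition 3.2 (boundary-uniform slab mass gap for `β < 1/(8(d-1))`, here as the hypothesis `hgap`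
in the criterion's input shape) yields the `SU(N)` area law below `β*_{SU(N)} = 1/(8(d-1))` (CNS Definition 1.4; the tree's
`cnsThresholdSU d` once `THooftRegimeThresholds` lands). This is only the bookkeeping implication;
Prop. 3.2 itself is not vendored here. [cite: CaoNissimSheffield2025dynamical, Theorem 1.6] -/
theorem durhuusFrohlich_areaLaw_of_slabClustering.hasAreaLaw_of_lt_cnsThreshold
    (h : durhuusFrohlich_areaLaw_of_slabClustering d N) (hd : 2 ≤ d) (hN : 2 ≤ N)
    (hgap : ∀ β : ℝ, 0 ≤ β → β < 1 / (8 * ((d : ℝ) - 1)) → ∃ C₁ C₂ : ℝ, 0 < C₂ ∧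
      ∀ (L : ℕ) [NeZero L] (A B : Edge (d - 1) L → Matrix.unitaryGroup (Fin N) ℂ)
        (x y : Site (d - 1) L) (i j k l : Fin N) (φ ψ : ℂ → ℝ),
        (φ = Complex.re ∨ φ = Complex.im) → (ψ = Complex.re ∨ ψ = Complex.im) →
          |cov[fun Q => φ ((Q x : Matrix (Fin N) (Fin N) ℂ) i j),
              fun Q => ψ ((((Q y)⁻¹ : Matrix.specialUnitaryGroup (Fin N) ℂ) :
                Matrix (Fin N) (Fin N) ℂ) k l);
              slabMeasure N β A B]| ≤ C₁ * Real.exp (-C₂ * torusGraphDist x y))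
    {β : ℝ} (hβ0 : 0 ≤ β) (hβ : β < 1 / (8 * ((d : ℝ) - 1))) :
    HasAreaLaw d (fundamentalRep (Fin N)) ((N : ℝ) * β) :=
  h.hasAreaLaw hd hN hβ0 (hgap β hβ0 hβ)

end Criterion

end Literature.MathematicalPhysics.QuantumFieldTheory
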